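import Mathlib
import Summits.NavierStokesRegularity.NavierStokesRegularity.Theorems.EulerZoomLiouvillePowerGaugeEulerLiouvilleMeanStrainTools
import HarnessLib

/-!
# Crux `EulerZoomLiouville.PowerGaugeEulerLiouville` (stmt-NavierStokesRegularity-19832): THE MEAN STRAIN LAW — plate t59-MS of nsreg-p2 ROUND-54 «THE TRACE»

Width/portrait piece for THE ONE STATEMENT `stub_selfSimilarC2Needle` (LEAD skeleton `Cruxes/PowerGaugeEulerLiouville/Lines/birth.lean` v111,
ns-typeII-p2 g16), `--supports stmt-NavierStokesRegularity-19832 --as helper`.  Text = nsreg-p2 g44's `NsregP2.R54.Trace.MeanStrainLaw ρ V`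
(`r54/Sketch54.lean` sha16 f78682d2f4ee3f27) VERBATIM with `simFlow` unfolded, for `−2 < ρ ≤ 1`.

For a self-similar Euler profile `(V, P)` with exponent `γ = 1/(2+ρ)`, centre `0`, and FINITE WEIGHTED STRAIN BUDGET
`E = ∫ ‖DV(y)‖² ‖y‖^{ρ−1} dy < ∞`, in the lineage's cut-off idiom (a `C²` copy `V′`, `‖DV′‖ ≤ K`, `V′ = V` on `ball 0 Rbig`, flow
`Ψ_s = ODE.evolutionMap (fun _ => selfSimilarTransport γ 0 V′) 0 s`): for `C, L ≥ 1` there is `M = M(V, C, L, ρ)` such that for every horizon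
`S ≥ 0` (with `2CLe^{γS} < Rbig`) the label-mean over `B_L` of the strain accumulated while the trajectory stays in the `CL`-tube,
`∫_{B_L} ∫_0^S 𝟙{∀σ″≤σ: ‖Ψ_{σ″}y‖ ≤ CLe^{γσ″}} ‖DV′(Ψ_σ y)‖ dσ dy ≤ M` — UNIFORMLY in `S`, `V′`, `K`, `Rbig` (`meanStrainLaw`).
Proof (R54 §8): at a fixed `σ` the staying labels map injectively under `Ψ_σ` into `B̄(0, CLe^{γσ})` with Jacobian `e^{3γσ}`
(`Trace.lintegral_comp_flow_section_eq`), so their strain integral is `≤ e^{−3γσ}∫_{B̄_{R_σ}}‖DV‖ ≤ e^{−3γσ}|B̄_{R_σ}|^{1/2}(R_σ^{1−ρ}E)^{1/2}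
= (CL)^{(4−ρ)/2}(|B̄_1|E)^{1/2} e^{−σ/2}` (`strain_bookkeeping`: `γ(1+ρ/2) = ½` exactly; `lintegral_strain_slice_le`); Tonelli over
`ball 0 L × Icc 0 S` (`measurableSet_forwardStayProd`) and `∫_0^S e^{−σ/2} ≤ 2` give `M = 2(CL)^{(4−ρ)/2}(|B̄_1|E)^{1/2}`.
Reading (R54 §C): along a.e. non-escaping trajectory the strain is integrable — the hypothesis of THE RAY LAW.

HONEST FRAMING: a portrait instrument about HYPOTHETICAL profiles; nothing about the crux E (19832 OPEN) or NS regularity is proved.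
[nsreg-p2 R54 §C t59-MS; cite: ConstantinIgnatovaVicol2026Putative, §3.4.1 eq. (3.21)–(3.22)]
-/

noncomputable section

set_option linter.dupNamespace false

open MeasureTheory Set Filter Topology Metric Function
open scoped RealInnerProductSpace NNReal ENNReal ContDiff

namespace Summit.NavierStokesRegularity.NavierStokesRegularity.Theorems.PowerGaugeEulerLiouville.Trace

open Literature.Analysis Literature.Analysis.FluidPDE
open Summit.NavierStokesRegularity.NavierStokesRegularity.Theorems.PowerGaugeEulerLiouville.BernoulliLandscape
open Summit.NavierStokesRegularity.NavierStokesRegularity.Theorems.PowerGaugeEulerLiouville.NeedleFeeding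

/-- **The strain of the staying labels at a fixed time.**  In the cut-off idiom, for `σ ∈ [0, S]` the labels `y ∈ B_L` whose orbit stays in
the `CL`-tube on `[0, σ]` satisfy `∫ ‖DV′(Ψ_σ y)‖ dy ≤ (CL)^{(4−ρ)/2} e^{−σ/2} (|B̄_1|·E)^{1/2}`, `E = ∫ ‖DV‖²‖y‖^{ρ−1}` (`ρ ≤ 1`):
area formula with Jacobian `e^{3γσ}`, image in `B̄(0, CLe^{γσ})` where `DV′ = DV`, Cauchy–Schwarz, weighted budget.
[nsreg-p2 R54 §C t59-MS; cite: ConstantinIgnatovaVicol2026Putative, §3.4.1 eq. (3.22)] -/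
theorem lintegral_strain_slice_le {ρ : ℝ} (hρ : -2 < ρ) (hρ1 : ρ ≤ 1)
    {V V' : EuclideanSpace ℝ (Fin 3) → EuclideanSpace ℝ (Fin 3)} {P : EuclideanSpace ℝ (Fin 3) → ℝ}
    (hprof : IsSelfSimilarEulerProfile (1 / (2 + ρ)) 0 V P) {C L S K Rbig : ℝ} (hC : 1 ≤ C) (hL : 1 ≤ L)
    (hV' : ContDiff ℝ 2 V') (hK : ∀ y, ‖fderiv ℝ V' y‖ ≤ K) (hRbig : 2 * C * L * Real.exp (S / (2 + ρ)) < Rbig)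
    (hVV' : ∀ w ∈ ball (0 : EuclideanSpace ℝ (Fin 3)) Rbig, V' w = V w) {σ : ℝ} (hσ : σ ∈ Icc 0 S) :
    ∫⁻ y in {y ∈ ball (0 : EuclideanSpace ℝ (Fin 3)) L | ∀ σ' ∈ Icc 0 σ,
        ‖ODE.evolutionMap (fun _ : ℝ => selfSimilarTransport (1 / (2 + ρ)) (0 : EuclideanSpace ℝ (Fin 3)) V') 0 σ' y‖ ≤
          C * L * Real.exp (σ' / (2 + ρ))},
        ‖fderiv ℝ V' (ODE.evolutionMap (fun _ : ℝ => selfSimilarTransport (1 / (2 + ρ)) (0 : EuclideanSpace ℝ (Fin 3)) V') 0 σ y)‖ₑ ≤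
      ENNReal.ofReal ((C * L) ^ ((4 - ρ) / 2) * Real.exp (-(σ / 2))) *
        (volume (ball (0 : EuclideanSpace ℝ (Fin 3)) 1) *
          ∫⁻ y, ‖fderiv ℝ V y‖ₑ ^ 2 * ENNReal.ofReal (‖y‖ ^ (ρ - 1))) ^ (1 / 2 : ℝ) := by
  have h2ρ : 0 < 2 + ρ := by linarith
  set γ : ℝ := 1 / (2 + ρ) with hγ
  have hCL : 1 ≤ C * L := by nlinarith
  have hCL0 : 0 ≤ C * L := by linarith
  obtain ⟨Φ, hΦ⟩ : ∃ Φ : ℝ → EuclideanSpace ℝ (Fin 3) → EuclideanSpace ℝ (Fin 3),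
      Φ = ODE.evolutionMap (fun _ : ℝ => selfSimilarTransport γ (0 : EuclideanSpace ℝ (Fin 3)) V') 0 := ⟨_, rfl⟩
  -- radii
  set Rσ : ℝ := C * L * Real.exp (σ / (2 + ρ)) with hRσ
  set RS : ℝ := C * L * Real.exp (S / (2 + ρ)) with hRS
  have hRσ1 : 1 ≤ Rσ := by
    have : 1 ≤ Real.exp (σ / (2 + ρ)) := Real.one_le_exp (div_nonneg hσ.1 h2ρ.le)
    nlinarith
  have hRσ0 : 0 < Rσ := by linarith
  have hσS : Rσ ≤ RS := by
    have : Real.exp (σ / (2 + ρ)) ≤ Real.exp (S / (2 + ρ)) :=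
      Real.exp_le_exp.2 (div_le_div_of_nonneg_right hσ.2 h2ρ.le)
    exact mul_le_mul_of_nonneg_left this hCL0
  have hRSbig : RS < Rbig := by
    have : 0 ≤ RS := by positivity
    linarith
  -- `V′` is divergence-free on `‖z‖ ≤ RS`, and `DV′ = DV` on `‖z‖ ≤ Rσ`
  have hfd : ∀ z : EuclideanSpace ℝ (Fin 3), ‖z‖ ≤ RS → fderiv ℝ V' z = fderiv ℝ V z := by
    intro z hz
    have hzB : z ∈ ball (0 : EuclideanSpace ℝ (Fin 3)) Rbig := by
      rw [mem_ball_zero_iff]; exact lt_of_le_of_lt hz hRSbig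
    have hEq : V' =ᶠ[𝓝 z] V := Filter.eventually_of_mem (isOpen_ball.mem_nhds hzB) fun w hw => hVV' w hw
    exact hEq.fderiv_eq
  have hdiv : ∀ z : EuclideanSpace ℝ (Fin 3), ‖z‖ ≤ RS → VectorCalculus.divergence V' z = 0 := by
    intro z hz
    have h0 := hprof.divFree z
    unfold VectorCalculus.divergence at h0 ⊢
    rw [hfd z hz]; exact h0
  -- the label set
  obtain ⟨F, hF⟩ : ∃ F : Set (EuclideanSpace ℝ (Fin 3)), F = {y ∈ ball (0 : EuclideanSpace ℝ (Fin 3)) L |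
      ∀ σ' ∈ Icc 0 σ, ‖Φ σ' y‖ ≤ C * L * Real.exp (σ' / (2 + ρ))} := ⟨_, rfl⟩
  have hFm : MeasurableSet F := by
    rw [hF, show {y ∈ ball (0 : EuclideanSpace ℝ (Fin 3)) L | ∀ σ' ∈ Icc 0 σ, ‖Φ σ' y‖ ≤ C * L * Real.exp (σ' / (2 + ρ))} =
      ball (0 : EuclideanSpace ℝ (Fin 3)) L ∩ {y | ∀ σ' ∈ Icc 0 σ, ‖Φ σ' y‖ ≤ C * L * Real.exp (σ' / (2 + ρ))} by
        ext y; simp only [mem_setOf_eq, mem_inter_iff]]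
    rw [hΦ]
    exact measurableSet_ball.inter
      (isClosed_forwardStay_fun (γ := γ) hV' hK σ (fun σ' => C * L * Real.exp (σ' / (2 + ρ)))).measurableSet
  have hstay : ∀ y ∈ F, ∀ σ' ∈ Icc 0 σ, ‖Φ σ' y‖ ≤ RS := by
    intro y hy σ' hσ'
    rw [hF] at hy
    refine (hy.2 σ' hσ').trans ?_
    have : Real.exp (σ' / (2 + ρ)) ≤ Real.exp (S / (2 + ρ)) :=
      Real.exp_le_exp.2 (div_le_div_of_nonneg_right (hσ'.2.trans hσ.2) h2ρ.le)
    exact mul_le_mul_of_nonneg_left this hCL0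
  have himg : Φ σ '' F ⊆ closedBall (0 : EuclideanSpace ℝ (Fin 3)) Rσ := by
    rintro _ ⟨y, hy, rfl⟩
    rw [mem_closedBall_zero_iff]
    rw [hF] at hy
    exact hy.2 σ ⟨hσ.1, le_rfl⟩
  -- the area formula
  have hgm : Measurable fun z : EuclideanSpace ℝ (Fin 3) => ‖fderiv ℝ V' z‖ₑ :=
    (hV'.continuous_fderiv (by norm_num)).measurable.enorm
  have hgVm : Measurable fun z : EuclideanSpace ℝ (Fin 3) => ‖fderiv ℝ V z‖ₑ :=
    (hprof.contDiff_velocity.continuous_fderiv (by norm_num)).measurable.enorm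
  have harea := lintegral_comp_flow_section_eq (γ := γ) hV' hK hσ.1 hdiv hFm (by rw [hΦ] at hstay; exact hstay) hgm
  rw [← hΦ] at harea
  -- `∫_F ‖DV′(Ψ_σ y)‖ = e^{−3γσ} ∫_{Ψ_σ F} ‖DV′‖ ≤ e^{−3γσ} ∫_{B̄_{Rσ}} ‖DV‖`
  have hA : ∫⁻ y in F, ‖fderiv ℝ V' (Φ σ y)‖ₑ =
      ENNReal.ofReal (Real.exp (-(3 * γ * σ))) * ∫⁻ z in Φ σ '' F, ‖fderiv ℝ V' z‖ₑ := by
    rw [← harea, ← mul_assoc, ← ENNReal.ofReal_mul (Real.exp_pos _).le, ← Real.exp_add,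
      show -(3 * γ * σ) + 3 * γ * σ = 0 by ring, Real.exp_zero, ENNReal.ofReal_one, one_mul]
  have hB : ∫⁻ z in Φ σ '' F, ‖fderiv ℝ V' z‖ₑ ≤ ∫⁻ z in closedBall (0 : EuclideanSpace ℝ (Fin 3)) Rσ, ‖fderiv ℝ V z‖ₑ := by
    refine (lintegral_mono_set himg).trans (le_of_eq ?_)
    refine setLIntegral_congr_fun measurableSet_closedBall (fun z hz => ?_)
    rw [mem_closedBall_zero_iff] at hz
    rw [hfd z (hz.trans hσS)]
  -- Cauchy–Schwarz and the weighted budget on `B̄_{Rσ}`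
  set E : ℝ≥0∞ := ∫⁻ y, ‖fderiv ℝ V y‖ₑ ^ 2 * ENNReal.ofReal (‖y‖ ^ (ρ - 1)) with hE
  set v₁ : ℝ≥0∞ := volume (ball (0 : EuclideanSpace ℝ (Fin 3)) 1) with hv₁
  have hCS := setLIntegral_le_sqrt_measure_mul_sqrt (s := closedBall (0 : EuclideanSpace ℝ (Fin 3)) Rσ) hgVm.aemeasurable
  have hW := setLIntegral_closedBall_sq_le_of_weight hρ1 hRσ1 (fun z => ‖fderiv ℝ V z‖ₑ)
  have hvol : volume (closedBall (0 : EuclideanSpace ℝ (Fin 3)) Rσ) = ENNReal.ofReal (Rσ ^ 3) * v₁ := by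
    rw [hv₁, Measure.addHaar_closedBall volume (0 : EuclideanSpace ℝ (Fin 3)) hRσ0.le, finrank_euclideanSpace,
      Fintype.card_fin]
  have hC' : ∫⁻ z in closedBall (0 : EuclideanSpace ℝ (Fin 3)) Rσ, ‖fderiv ℝ V z‖ₑ ≤
      ENNReal.ofReal (Rσ ^ ((4 - ρ) / 2)) * (v₁ * E) ^ (1 / 2 : ℝ) := by
    refine hCS.trans ?_
    rw [hvol]
    calc (ENNReal.ofReal (Rσ ^ 3) * v₁) ^ (1 / 2 : ℝ) *
          (∫⁻ z in closedBall (0 : EuclideanSpace ℝ (Fin 3)) Rσ, ‖fderiv ℝ V z‖ₑ ^ 2) ^ (1 / 2 : ℝ)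
        ≤ (ENNReal.ofReal (Rσ ^ 3) * v₁) ^ (1 / 2 : ℝ) * (ENNReal.ofReal (Rσ ^ (1 - ρ)) * E) ^ (1 / 2 : ℝ) := by
          gcongr
      _ = (ENNReal.ofReal (Rσ ^ 3 * Rσ ^ (1 - ρ)) * (v₁ * E)) ^ (1 / 2 : ℝ) := by
          rw [← ENNReal.mul_rpow_of_nonneg _ _ (by norm_num : (0 : ℝ) ≤ 1 / 2),
            ENNReal.ofReal_mul (pow_nonneg hRσ0.le 3)]
          congr 1
          ring
      _ = ENNReal.ofReal (Rσ ^ ((4 - ρ) / 2)) * (v₁ * E) ^ (1 / 2 : ℝ) := by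
          rw [ENNReal.mul_rpow_of_nonneg _ _ (by norm_num : (0 : ℝ) ≤ 1 / 2),
            ENNReal.ofReal_rpow_of_nonneg (by positivity) (by norm_num : (0 : ℝ) ≤ 1 / 2)]
          congr 2
          rw [← Real.rpow_natCast Rσ 3, ← Real.rpow_add hRσ0, ← Real.rpow_mul hRσ0.le]
          congr 1
          push_cast
          ring
  -- assemble
  have hfin : ∫⁻ y in F, ‖fderiv ℝ V' (Φ σ y)‖ₑ ≤
      ENNReal.ofReal ((C * L) ^ ((4 - ρ) / 2) * Real.exp (-(σ / 2))) * (v₁ * E) ^ (1 / 2 : ℝ) := by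
    rw [hA]
    calc ENNReal.ofReal (Real.exp (-(3 * γ * σ))) * ∫⁻ z in Φ σ '' F, ‖fderiv ℝ V' z‖ₑ
        ≤ ENNReal.ofReal (Real.exp (-(3 * γ * σ))) * (ENNReal.ofReal (Rσ ^ ((4 - ρ) / 2)) * (v₁ * E) ^ (1 / 2 : ℝ)) :=
          mul_le_mul_right (hB.trans hC') _
      _ = ENNReal.ofReal (Real.exp (-(3 * γ * σ)) * Rσ ^ ((4 - ρ) / 2)) * (v₁ * E) ^ (1 / 2 : ℝ) := by
          rw [← mul_assoc, ← ENNReal.ofReal_mul (Real.exp_pos _).le]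
      _ = ENNReal.ofReal ((C * L) ^ ((4 - ρ) / 2) * Real.exp (-(σ / 2))) * (v₁ * E) ^ (1 / 2 : ℝ) := by
          rw [hRσ, hγ, show -(3 * (1 / (2 + ρ)) * σ) = -(3 * (1 / (2 + ρ)) * σ) from rfl, strain_bookkeeping h2ρ hCL0]
  rw [hF, hΦ] at hfin
  exact hfin

/-- ★ **THE MEAN STRAIN LAW (t59-MS, `NsregP2.R54.Trace.MeanStrainLaw ρ V` VERBATIM, `−2 < ρ ≤ 1`).**  For a self-similar Euler profile
`(V, P)` with exponent `1/(2+ρ)` and finite weighted strain budget `∫‖DV(y)‖²‖y‖^{ρ−1}dy`, and `C, L ≥ 1`, there is `M` such that in the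
cut-off idiom, for every horizon `S ≥ 0` (`2CLe^{S/(2+ρ)} < Rbig`), the label-mean over `B_L` of the strain accumulated along the forward
similarity trajectory while it stays in the `CL`-tube is `≤ M` — independently of `S`, `V′`, `K`, `Rbig`.  Tonelli over labels × time, the
Jacobian `e^{3γσ}` on staying labels, Cauchy–Schwarz, the weighted budget, and `γ(1+ρ/2) = ½` (`∫_0^S e^{−σ/2} ≤ 2`).
[nsreg-p2 R54 §C t59-MS; cite: ConstantinIgnatovaVicol2026Putative, §3.4.1 eq. (3.21)–(3.22)] -/
theorem meanStrainLaw {ρ : ℝ} (hρ : -2 < ρ) (hρ1 : ρ ≤ 1) (V : EuclideanSpace ℝ (Fin 3) → EuclideanSpace ℝ (Fin 3)) :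
    ∀ P : EuclideanSpace ℝ (Fin 3) → ℝ, IsSelfSimilarEulerProfile (1 / (2 + ρ)) 0 V P →
    (∫⁻ y, ‖fderiv ℝ V y‖ₑ ^ 2 * ENNReal.ofReal (‖y‖ ^ (ρ - 1))) ≠ ⊤ →
    ∀ C L : ℝ, 1 ≤ C → 1 ≤ L → ∃ M : ℝ, ∀ (S : ℝ) (V' : EuclideanSpace ℝ (Fin 3) → EuclideanSpace ℝ (Fin 3)) (K Rbig : ℝ),
      0 ≤ S → ContDiff ℝ 2 V' →
      (∀ y, ‖fderiv ℝ V' y‖ ≤ K) → 2 * C * L * Real.exp (S / (2 + ρ)) < Rbig →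
      (∀ w ∈ ball (0 : EuclideanSpace ℝ (Fin 3)) Rbig, V' w = V w) →
      ∫⁻ y in ball (0 : EuclideanSpace ℝ (Fin 3)) L, ∫⁻ σ in Icc 0 S,
          indicator {σ' : ℝ | ∀ σ'' ∈ Icc 0 σ',
              ‖ODE.evolutionMap (fun _ : ℝ => selfSimilarTransport (1 / (2 + ρ)) (0 : EuclideanSpace ℝ (Fin 3)) V') 0 σ'' y‖ ≤
                C * L * Real.exp (σ'' / (2 + ρ))}
            (fun σ' : ℝ => ‖fderiv ℝ V'
              (ODE.evolutionMap (fun _ : ℝ => selfSimilarTransport (1 / (2 + ρ)) (0 : EuclideanSpace ℝ (Fin 3)) V') 0 σ' y)‖ₑ) σ ≤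
        ENNReal.ofReal M := by
  intro P hprof hE C L hC hL
  have h2ρ : 0 < 2 + ρ := by linarith
  have hCL0 : 0 ≤ C * L := by nlinarith
  set γ : ℝ := 1 / (2 + ρ) with hγ
  set E : ℝ≥0∞ := ∫⁻ y, ‖fderiv ℝ V y‖ₑ ^ 2 * ENNReal.ofReal (‖y‖ ^ (ρ - 1)) with hEdef
  set v₁ : ℝ≥0∞ := volume (ball (0 : EuclideanSpace ℝ (Fin 3)) 1) with hv₁
  set Q : ℝ≥0∞ := (v₁ * E) ^ (1 / 2 : ℝ) with hQ
  have hQtop : Q ≠ ⊤ := by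
    refine ENNReal.rpow_ne_top_of_nonneg (by norm_num) (ENNReal.mul_ne_top ?_ hE)
    exact (measure_ball_lt_top).ne
  set c : ℝ := (C * L) ^ ((4 - ρ) / 2) with hc
  have hc0 : 0 ≤ c := Real.rpow_nonneg hCL0 _
  refine ⟨2 * c * Q.toReal, fun S V' K Rbig hS hV' hK hRbig hVV' => ?_⟩
  obtain ⟨Φ, hΦ⟩ : ∃ Φ : ℝ → EuclideanSpace ℝ (Fin 3) → EuclideanSpace ℝ (Fin 3),
      Φ = ODE.evolutionMap (fun _ : ℝ => selfSimilarTransport γ (0 : EuclideanSpace ℝ (Fin 3)) V') 0 := ⟨_, rfl⟩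
  rw [← hΦ]
  -- the integrand on `labels × time` and its measurability
  obtain ⟨T, hT⟩ : ∃ T : Set (EuclideanSpace ℝ (Fin 3) × ℝ),
      T = {p | ∀ σ'' ∈ Icc 0 p.2, ‖Φ σ'' p.1‖ ≤ C * L * Real.exp (σ'' / (2 + ρ))} := ⟨_, rfl⟩
  have hTm : MeasurableSet T := by
    rw [hT, hΦ]
    exact measurableSet_forwardStayProd (γ := γ) hV' hK (f := fun σ'' => C * L * Real.exp (σ'' / (2 + ρ))) (by fun_prop)
  have hHm : Measurable fun p : EuclideanSpace ℝ (Fin 3) × ℝ => ‖fderiv ℝ V' (Φ p.2 p.1)‖ₑ := by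
    rw [hΦ]
    exact ((hV'.continuous_fderiv (by norm_num)).comp
      ((continuous_flow_uncurry (γ := γ) hV' hK).comp (continuous_snd.prodMk continuous_fst))).measurable.enorm
  have hunc : (Function.uncurry fun (y : EuclideanSpace ℝ (Fin 3)) (σ : ℝ) =>
      indicator {σ' : ℝ | ∀ σ'' ∈ Icc 0 σ', ‖Φ σ'' y‖ ≤ C * L * Real.exp (σ'' / (2 + ρ))}
        (fun σ' : ℝ => ‖fderiv ℝ V' (Φ σ' y)‖ₑ) σ) =
      T.indicator fun p => ‖fderiv ℝ V' (Φ p.2 p.1)‖ₑ := by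
    funext p
    obtain ⟨y, σ⟩ := p
    rw [hT, Function.uncurry_apply_pair]
    by_cases h : ∀ σ'' ∈ Icc 0 σ, ‖Φ σ'' y‖ ≤ C * L * Real.exp (σ'' / (2 + ρ))
    · rw [indicator_of_mem (show σ ∈ {σ' : ℝ | ∀ σ'' ∈ Icc 0 σ', ‖Φ σ'' y‖ ≤ C * L * Real.exp (σ'' / (2 + ρ))} from h),
        indicator_of_mem (show (y, σ) ∈ {p : EuclideanSpace ℝ (Fin 3) × ℝ |
          ∀ σ'' ∈ Icc 0 p.2, ‖Φ σ'' p.1‖ ≤ C * L * Real.exp (σ'' / (2 + ρ))} from h)]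
    · rw [indicator_of_notMem (show σ ∉ {σ' : ℝ | ∀ σ'' ∈ Icc 0 σ', ‖Φ σ'' y‖ ≤ C * L * Real.exp (σ'' / (2 + ρ))} from h),
        indicator_of_notMem (show (y, σ) ∉ {p : EuclideanSpace ℝ (Fin 3) × ℝ |
          ∀ σ'' ∈ Icc 0 p.2, ‖Φ σ'' p.1‖ ≤ C * L * Real.exp (σ'' / (2 + ρ))} from h)]
  have hmeas : AEMeasurable (Function.uncurry fun (y : EuclideanSpace ℝ (Fin 3)) (σ : ℝ) =>
      indicator {σ' : ℝ | ∀ σ'' ∈ Icc 0 σ', ‖Φ σ'' y‖ ≤ C * L * Real.exp (σ'' / (2 + ρ))}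
        (fun σ' : ℝ => ‖fderiv ℝ V' (Φ σ' y)‖ₑ) σ)
      ((volume.restrict (ball (0 : EuclideanSpace ℝ (Fin 3)) L)).prod (volume.restrict (Icc 0 S))) := by
    rw [hunc]
    exact (hHm.indicator hTm).aemeasurable
  -- Tonelli
  rw [lintegral_lintegral_swap hmeas]
  -- the slice bound
  have hslice : ∀ σ ∈ Icc (0 : ℝ) S, ∫⁻ y in ball (0 : EuclideanSpace ℝ (Fin 3)) L,
      indicator {σ' : ℝ | ∀ σ'' ∈ Icc 0 σ', ‖Φ σ'' y‖ ≤ C * L * Real.exp (σ'' / (2 + ρ))}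
        (fun σ' : ℝ => ‖fderiv ℝ V' (Φ σ' y)‖ₑ) σ ≤
      ENNReal.ofReal (c * Real.exp (-(σ / 2))) * Q := by
    intro σ hσ
    have hSm : MeasurableSet {y : EuclideanSpace ℝ (Fin 3) | ∀ σ'' ∈ Icc 0 σ, ‖Φ σ'' y‖ ≤ C * L * Real.exp (σ'' / (2 + ρ))} := by
      rw [hΦ]
      exact (isClosed_forwardStay_fun (γ := γ) hV' hK σ (fun σ' => C * L * Real.exp (σ' / (2 + ρ)))).measurableSet
    have e1 : ∀ y : EuclideanSpace ℝ (Fin 3),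
        indicator {σ' : ℝ | ∀ σ'' ∈ Icc 0 σ', ‖Φ σ'' y‖ ≤ C * L * Real.exp (σ'' / (2 + ρ))}
          (fun σ' : ℝ => ‖fderiv ℝ V' (Φ σ' y)‖ₑ) σ =
        indicator {y : EuclideanSpace ℝ (Fin 3) | ∀ σ'' ∈ Icc 0 σ, ‖Φ σ'' y‖ ≤ C * L * Real.exp (σ'' / (2 + ρ))}
          (fun y => ‖fderiv ℝ V' (Φ σ y)‖ₑ) y := by
      intro y
      by_cases h : ∀ σ'' ∈ Icc 0 σ, ‖Φ σ'' y‖ ≤ C * L * Real.exp (σ'' / (2 + ρ))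
      · rw [indicator_of_mem (show σ ∈ {σ' : ℝ | ∀ σ'' ∈ Icc 0 σ', ‖Φ σ'' y‖ ≤ C * L * Real.exp (σ'' / (2 + ρ))} from h),
          indicator_of_mem (show y ∈ {y : EuclideanSpace ℝ (Fin 3) |
            ∀ σ'' ∈ Icc 0 σ, ‖Φ σ'' y‖ ≤ C * L * Real.exp (σ'' / (2 + ρ))} from h)]
      · rw [indicator_of_notMem (show σ ∉ {σ' : ℝ | ∀ σ'' ∈ Icc 0 σ', ‖Φ σ'' y‖ ≤ C * L * Real.exp (σ'' / (2 + ρ))} from h),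
          indicator_of_notMem (show y ∉ {y : EuclideanSpace ℝ (Fin 3) |
            ∀ σ'' ∈ Icc 0 σ, ‖Φ σ'' y‖ ≤ C * L * Real.exp (σ'' / (2 + ρ))} from h)]
    simp_rw [e1]
    rw [lintegral_indicator hSm, Measure.restrict_restrict hSm]
    have eF : {y : EuclideanSpace ℝ (Fin 3) | ∀ σ'' ∈ Icc 0 σ, ‖Φ σ'' y‖ ≤ C * L * Real.exp (σ'' / (2 + ρ))} ∩
        ball (0 : EuclideanSpace ℝ (Fin 3)) L =
        {y ∈ ball (0 : EuclideanSpace ℝ (Fin 3)) L | ∀ σ' ∈ Icc 0 σ, ‖Φ σ' y‖ ≤ C * L * Real.exp (σ' / (2 + ρ))} := by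
      ext y; simp only [mem_inter_iff, mem_setOf_eq]; tauto
    rw [eF]
    have h := lintegral_strain_slice_le hρ hρ1 hprof hC hL hV' hK hRbig hVV' hσ
    rw [← hΦ] at h
    exact h
  calc ∫⁻ σ in Icc 0 S, ∫⁻ y in ball (0 : EuclideanSpace ℝ (Fin 3)) L,
        indicator {σ' : ℝ | ∀ σ'' ∈ Icc 0 σ', ‖Φ σ'' y‖ ≤ C * L * Real.exp (σ'' / (2 + ρ))}
          (fun σ' : ℝ => ‖fderiv ℝ V' (Φ σ' y)‖ₑ) σ
      ≤ ∫⁻ σ in Icc 0 S, ENNReal.ofReal (c * Real.exp (-(σ / 2))) * Q := setLIntegral_mono' measurableSet_Icc hslice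
    _ = (∫⁻ σ in Icc 0 S, ENNReal.ofReal (Real.exp (-(σ / 2)))) * (ENNReal.ofReal c * Q) := by
        rw [← lintegral_mul_const' _ _ (ENNReal.mul_ne_top ENNReal.ofReal_ne_top hQtop)]
        refine lintegral_congr fun σ => ?_
        rw [ENNReal.ofReal_mul hc0]
        ring
    _ ≤ ENNReal.ofReal 2 * (ENNReal.ofReal c * Q) := mul_le_mul_left (lintegral_exp_neg_half_Icc_le hS) _
    _ = ENNReal.ofReal (2 * c * Q.toReal) := by
        rw [ENNReal.ofReal_mul (by positivity : (0 : ℝ) ≤ 2 * c), ENNReal.ofReal_mul (by norm_num : (0 : ℝ) ≤ 2),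
          ENNReal.ofReal_toReal hQtop, mul_assoc]

end Summit.NavierStokesRegularity.NavierStokesRegularity.Theorems.PowerGaugeEulerLiouville.Trace
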